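import Summits.RiemannHypothesis.RiemannHypothesis.Theorems.WeilGroundStateGroundStateSimpleEvenTrialUpperFConst
import Summits.RiemannHypothesis.RiemannHypothesis.Theorems.WeilTwoPrimeDeflM80PCert
import Literature.NumberTheory.LFunctions.WeilDeflationPenaltyPolyEval
import Summits.RiemannHypothesis.RiemannHypothesis.Theorems.GroundBartaEvenWinsBeyondArchDeflationM80PAssemblyT3
import Summits.RiemannHypothesis.RiemannHypothesis.Theorems.GroundBartaEvenWinsBeyondArchDeflationPSDFromBoundsM
import Summits.RiemannHypothesis.RiemannHypothesis.Theorems.GroundBartaEvenWinsBeyondArchDeflationMarkovY3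
import Summits.RiemannHypothesis.RiemannHypothesis.Theorems.GroundBartaEvenWinsBeyondArchDeflationCrossGram
import Summits.RiemannHypothesis.RiemannHypothesis.Theorems.GroundBartaEvenWinsBeyondArchDeflationCertBridgeWEven
import HarnessLib

/-!
# RiemannHypothesis / GroundBarta — rung 4 (`EvenWinsBeyondArch`, stmt-RiemannHypothesis-18807 / 18085), POSITIVITY BLOCK:
# the deflated Temple L-side of the EVEN sector at `c = 4023/5000` — window image and the final inequality modulo R-layer data

Helper file (`--supports stmt-RiemannHypothesis-18085`), RH-free.  Prover A g9 (`cert/gen_final_even80p.py`: the landed odd cell-5 module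
…DeflationM80FFinal with odd → even, i.e. prover B's `dt_weilEvenGroundEnergy_ge_of_deflCert_w` (…CertBridgeWEven) in place of the odd bridge,
the even-sector certificate `deflBound_weilCertDeflM80P` (`β₂₃ = 17/25`, `a₀ = 4023/5000`, `N = 271`, six EVEN Ritz penalties), the A-layer of the
six even trial vectors `m80Pv` (…M80PAssembly*, Markov-free entry bounds `m80PTAlo/hi`) and the killing-constant bound `M ≤ m80PMhi` of width
`3.4·10⁻²¹` (…MarkovY3)).

* `m80PF` — the window image of the six even trial vectors `m80Pv i = 𝟙·P_i(x/b)` (`m80P_mask` identifies them with the certificate's penalties);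
* `dt_m80P_evenLower_of_gramW` — `λ ≤ ε_ev(4023/5000)` modulo prover B's WEIGHTED R-layer data (weighted residual norms `∫ w‖r_i‖² ≤ sW_i`, boxes for
  `∫ w Re(r_i r̄_j)`; `w = wE = 1/(17/25 − κ₂ − λ)` on `|y| ≥ y₁`, `wI = 1/(17/25 − λ)` inside; `κ₂ ≥ (log 2)/2`, `y₁ ≤ log 4 − 4023/5000`) and a
  kernel certificate for `A − λG − R_w`.  With `λ = 0` this is the positivity-grade even block: together with the landed odd block
  `m80F_oddLower_litW` it gives `WeilPositivityOn (4023/5000)` (`dt_weilPositivityOn`).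
-/

set_option linter.dupNamespace false

noncomputable section

open MeasureTheory Set
open scoped BigOperators ComplexConjugate

namespace Summit.RiemannHypothesis.RiemannHypothesis.Theorems.EvenWinsBeyondArch


open Literature.NumberTheory.LFunctions Literature.Analysis.ValidatedNumerics.ExpPoly
open Literature.Analysis.ValidatedNumerics.PolyMP Summit.RiemannHypothesis.RiemannHypothesis.Theorems.EvenWinsBeyondArch.ArchM80P
open Summit.RiemannHypothesis.RiemannHypothesis.Theorems.OddSector (weilDirichletEnergy₂ weilPoleForm₂)
open Summit.RiemannHypothesis.RiemannHypothesis.Theorems.GroundStateSimpleEven (tuf_log_two_bounds)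

open Literature.Analysis.ValidatedNumerics.PolyMP

/-- The penalty list of certificate M80P has six entries. [folklore] -/
theorem m80P_Rlen : weilCertDeflM80PR.length = 6 := rfl

set_option maxHeartbeats 0 in
/-- The certificate's masked coefficient vectors are the trimmed data polynomials `P_i` padded with zeros. [folklore] -/
theorem m80P_trim : ∀ i : Fin 6, (List.range 272).map (maskV (weilCertDeflM80PR.get (Fin.cast m80P_Rlen.symm i))) =
    m80PP i ++ List.replicate (272 - (m80PP i).length) 0 := by
  decide +kernel

/-- Even parities and non-negative weights of the penalties. [folklore] -/
theorem m80P_Reven : (∀ i : Fin weilCertDeflM80PR.length, (weilCertDeflM80PR.get i).2.1 % 2 = 0) ∧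
    (∀ i : Fin weilCertDeflM80PR.length, 0 ≤ (weilCertDeflM80PR.get i).1) := by
  constructor <;> decide

/-- **The bridge's trial vectors are the A-layer vectors**: `𝟙_{[-c,c]}·maskPoly(r_i, 272, 18/25) = m80Pv i`. [folklore] -/
theorem m80P_mask (i : Fin 6) (x : ℝ) :
    (((Icc (-(4023 / 5000 : ℝ)) (4023 / 5000)).indicator (fun x ↦ maskPoly (weilCertDeflM80PR.get (Fin.cast m80P_Rlen.symm i)) 272 (4023 / 5000) x) x
        : ℝ) : ℂ) = m80Pv i x := by
  unfold m80Pv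
  rw [dt_wY_apply]
  push_cast
  congr 1
  by_cases hx : x ∈ Icc (-(4023 / 5000 : ℝ)) (4023 / 5000)
  · rw [indicator_of_mem hx, indicator_of_mem (by simpa using hx), maskPoly_eq_poly_eval_of_trim _ _ (m80P_trim i)]
  · rw [indicator_of_notMem hx, indicator_of_notMem (by simpa using hx)]

/-- The window image of `v_i` at `c = 4023/5000` (the bridge's `F_i`, stated for `m80Pv`). [folklore] -/
def m80PF (i : Fin 6) (y : ℝ) : ℂ :=
  (Icc (-(4023 / 5000 : ℝ)) (4023 / 5000)).indicator (fun y ↦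
      2 * (∫ x, m80Pv i x * (Real.cosh (x / 2) : ℂ)) * (Real.cosh (y / 2) : ℂ) -
        2 * (∫ x, m80Pv i x * (Real.sinh (x / 2) : ℂ)) * (Real.sinh (y / 2) : ℂ) +
      (∑ m ∈ weilPrimeIndex (4023 / 5000 : ℝ), (((ArithmeticFunction.vonMangoldt m : ℝ) / Real.sqrt m : ℝ) : ℂ) *
        (2 * m80Pv i y - m80Pv i (y - Real.log m) - m80Pv i (y + Real.log m))) +
      ∫ t in Ioi 0, (weilArchDensity t : ℂ) * (2 * m80Pv i y - m80Pv i (y - t) - m80Pv i (y + t))) y -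
    (weilMarkovConstant (4023 / 5000 : ℝ) : ℂ) * m80Pv i y

/-- The certified upper bound of the killing constant used in the certificate (…MarkovY3, width `3.4·10⁻²¹`). [folklore] -/
def m80PMhi : ℚ := 83141569444492860377393 / 10000000000000000000000

/-- **`λ ≤ ε_ev(4023/5000)` modulo WEIGHTED R-layer data** (edge-only sliver).  `W` is prover B's coefficient matrix; `wI, wE` the two
weight values (`wI = 1/(17/25 − λ)`, `wE = 1/(17/25 − κ₂ − λ)`, `κ₂ ≥ (log 2)/2`), `y₁ ≤ log 4 − 4023/5000` the edge threshold; `sW_i` bounds for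
`∫ w‖r_i‖²`, `[Rlo_ij, Rhi_ij]` (`i ≠ j`) boxes for `∫ w Re(r_i r̄_j)` (diagonal boxes `[sW_i, sW_i]`); `sc, P, E, D, L, δ` the scaled kernel
certificate of `A − λG − R_w` (`nEntry` at `β' = λ + 1`). [folklore] -/
theorem dt_m80P_evenLower_of_gramW (W : Fin 6 → Fin 6 → ℝ) (lam κ₂ wI wE y₁ : ℚ) (hκ : Real.log 2 / 2 ≤ (κ₂ : ℝ))
    (hlam : lam + κ₂ < 17 / 25) (hwI : wI = 1 / (17 / 25 - lam)) (hwE : wE = 1 / (17 / 25 - κ₂ - lam))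
    (hy : (y₁ : ℝ) ≤ Real.log 4 - 4023 / 5000) (sW : Fin 6 → ℚ)
    (hsW : ∀ i, ∫ y, {u : ℝ | (y₁ : ℝ) ≤ |u|}.piecewise (fun _ ↦ (wE : ℝ)) (fun _ ↦ (wI : ℝ)) y *
      ‖(m80PF i - ∑ l, W i l • m80Pv l) y‖ ^ 2 ≤ (sW i : ℝ))
    (Rlo Rhi : Fin 6 → Fin 6 → ℚ) (hRdiag : ∀ i, Rlo i i = sW i ∧ Rhi i i = sW i)
    (hR : ∀ i j, i ≠ j →
      (Rlo i j : ℝ) ≤ ∫ y, {u : ℝ | (y₁ : ℝ) ≤ |u|}.piecewise (fun _ ↦ (wE : ℝ)) (fun _ ↦ (wI : ℝ)) y *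
          ((m80PF i - ∑ l, W i l • m80Pv l) y * conj ((m80PF j - ∑ l, W j l • m80Pv l) y)).re ∧
        ∫ y, {u : ℝ | (y₁ : ℝ) ≤ |u|}.piecewise (fun _ ↦ (wE : ℝ)) (fun _ ↦ (wI : ℝ)) y *
          ((m80PF i - ∑ l, W i l • m80Pv l) y * conj ((m80PF j - ∑ l, W j l • m80Pv l) y)).re ≤ (Rhi i j : ℝ))
    {m : ℕ} (sc : Fin 6 → ℚ) (hsc : ∀ i, 0 < sc i) (P E : Fin 6 → Fin 6 → ℚ)
    (D : Fin m → ℚ) (L : Fin m → Fin 6 → ℚ) (δ : ℚ)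
    (hPE : ∀ i j, ∀ a ∈ [m80PTAlo i j - m80PMhi * m80PG i j, m80PTAhi i j - m80PMhi * m80PG i j],
      P i j - E i j ≤ sc i * sc j * nEntry (lam + 1) lam (m80PG i j) (Rhi i j) a ∧
        sc i * sc j * nEntry (lam + 1) lam (m80PG i j) (Rlo i j) a ≤ P i j + E i j)
    (hrow : ∀ i, ∑ j, E i j ≤ δ) (hcol : ∀ j, ∑ i, E i j ≤ δ) (hD : ∀ r, 0 ≤ D r)
    (hP : ∀ i j, P i j = δ * (if i = j then 1 else 0) + ∑ r, D r * L r i * L r j) :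
    (lam : ℝ) ≤ weilEvenGroundEnergy (4023 / 5000 : ℝ) := by
  classical
  have hc : (0 : ℝ) < 4023 / 5000 := by norm_num
  have hc5 : (4023 / 5000 : ℝ) ≤ Real.log 5 / 2 := by have := m80_le_log5; push_cast at this; linarith
  have hlamQ : ((lam : ℚ) : ℝ) + (κ₂ : ℝ) < 17 / 25 := by
    have h := (Rat.cast_lt (K := ℝ)).2 hlam; push_cast at h; exact h
  have hlamR : (lam : ℝ) < 17 / 25 - (κ₂ : ℝ) := by linarith
  have hlog0 : 0 < Real.log 2 / 2 := by positivity
  have hnI : (0 : ℝ) < 17 / 25 - lam := by linarith [hlog0.le.trans hκ]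
  have hnE : (0 : ℝ) < 17 / 25 - κ₂ - lam := by linarith
  have hwIR : (wI : ℝ) = 1 / (17 / 25 - (lam : ℝ)) := by rw [hwI]; push_cast; ring
  have hwER : (wE : ℝ) = 1 / (17 / 25 - (κ₂ : ℝ) - (lam : ℝ)) := by rw [hwE]; push_cast; ring
  have hcert := fun (g : ℝ → ℂ) (hg : IsWeilTest g) (hsupp : tsupport g ⊆ Icc (-(4023 / 5000 : ℝ)) (4023 / 5000))
      (heven : ∀ x, g (-x) = g x) ↦ deflBound_weilCertDeflM80P hg hsupp heven
  obtain ⟨hN1, ha0⟩ := params_weilCertDeflM80P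
  have hβ23 : ((weilCertDeflM80PBeta : ℚ) : ℝ) = 17 / 25 := by show (((17 / 25 : ℚ)) : ℝ) = _; norm_num
  simp only [hN1, ha0, hβ23] at hcert
  have hM : weilMarkovConstant (4023 / 5000 : ℝ) ≤ ((m80PMhi : ℚ) : ℝ) := by
    have h2 := m80_log2_lt; have h5 := m80_le_log5; push_cast at h2 h5
    have := (dt_weilMarkovConstant_sharp3 h2 h5).2; unfold m80PMhi; push_cast at this ⊢; exact this
  have hA := m80P_TA_mem
  have hG := m80P_inner
  -- the weight, the residuals and their weighted copies `r̃_i = √w · r_i`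
  set Ew : Set ℝ := {u : ℝ | (y₁ : ℝ) ≤ |u|} with hEw
  set w : ℝ → ℝ := Ew.piecewise (fun _ ↦ (wE : ℝ)) (fun _ ↦ (wI : ℝ)) with hwdef
  have hw0 : ∀ y, 0 ≤ w y := by
    intro y
    by_cases hy' : y ∈ Ew
    · rw [hwdef, Set.piecewise_eq_of_mem _ _ _ hy', hwER]; positivity
    · rw [hwdef, Set.piecewise_eq_of_notMem _ _ _ hy', hwIR]; positivity
  set r : Fin 6 → ℝ → ℂ := fun i ↦ m80PF i - ∑ l, W i l • m80Pv l with hr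
  set rt : Fin 6 → ℝ → ℂ := fun i y ↦ ((Real.sqrt (w y) : ℝ) : ℂ) * r i y with hrt
  have hrt_sq : ∀ i, ∫ y, ‖rt i y‖ ^ 2 = ∫ y, w y * ‖r i y‖ ^ 2 := fun i ↦
    integral_congr_ae (Filter.Eventually.of_forall fun y ↦ dt_norm_sq_sqrt_mul (hw0 y) _)
  have hrt_cross : ∀ i j, ∫ y, (rt i y * conj (rt j y)).re = ∫ y, w y * (r i y * conj (r j y)).re := fun i j ↦
    integral_congr_ae (Filter.Eventually.of_forall fun y ↦ dt_sqrt_mul_pairing_pt hw0 (r i) (r j) y)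
  -- the matrix `R'_w` (certified diagonal bounds, true weighted cross terms) and its boxes
  set Rm : Fin 6 → Fin 6 → ℝ := fun i j ↦ if i = j then ((sW i : ℚ) : ℝ) else ∫ y, (rt i y * conj (rt j y)).re with hRm
  have hRbox : ∀ i j, (Rlo i j : ℝ) ≤ Rm i j ∧ Rm i j ≤ (Rhi i j : ℝ) := by
    intro i j
    by_cases hij : i = j
    · subst hij
      obtain ⟨h1, h2⟩ := hRdiag i
      simp only [hRm, if_true, h1, h2]; exact ⟨le_rfl, le_rfl⟩
    · simp only [hRm, if_neg hij, hrt_cross, hr, hwdef, hEw]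
      exact hR i j hij
  -- kernel certificate ⇒ `(A − λG) − R'_w ⪰ 0` (β' = λ + 1)
  have hPE' : ∀ i j, ∀ β' ∈ [lam + 1, lam + 1], ∀ a ∈ [m80PTAlo i j - m80PMhi * m80PG i j, m80PTAhi i j - m80PMhi * m80PG i j],
      P i j - E i j ≤ sc i * sc j * nEntry β' lam (m80PG i j) (Rhi i j) a ∧
        sc i * sc j * nEntry β' lam (m80PG i j) (Rlo i j) a ≤ P i j + E i j := by
    intro i j β' hβ' a ha
    have : β' = lam + 1 := by simpa using hβ'
    subst this
    exact hPE i j a ha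
  have hN := dt_hN_of_boundsT₃
    (fun i j ↦ weilPoleForm₂ (m80Pv i) (m80Pv j) + weilDirichletEnergy₂ (((4023 / 5000 : ℚ)) : ℝ) (m80Pv i) (m80Pv j))
    m80PTAlo m80PTAhi m80PG hA (fun i j ↦ ∫ x, (m80Pv i x * conj (m80Pv j x)).re) hG
    (M := weilMarkovConstant (4023 / 5000 : ℝ)) m80PMhi hM m80PGD m80PGL m80P_G_ldl.1 m80P_G_ldl.2
    (β := (lam : ℝ) + 1) (lam + 1) (lam + 1) (by push_cast; exact ⟨le_rfl, le_rfl⟩) Rm Rlo Rhi hRbox lam (by linarith)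
    sc hsc P E D L δ hPE' hrow hcol hD hP
  have h1825 : (((4023 / 5000 : ℚ)) : ℝ) = (4023 / 5000 : ℝ) := by norm_num
  simp only [h1825, add_sub_cancel_left, one_mul] at hN
  -- cross-Gram criterion on the weighted residuals ⇒ the bridge's weighted `hPSD`
  have hsR : ∀ i, ∫ y, ‖rt i y‖ ^ 2 ≤ ((sW i : ℚ) : ℝ) := fun i ↦ by
    rw [hrt_sq]; simpa only [hr, hwdef, hEw] using hsW i
  have hPSD := dt_psd_of_crossGram
    (fun i j ↦ (weilPoleForm₂ (m80Pv i) (m80Pv j) + weilDirichletEnergy₂ (4023 / 5000 : ℝ) (m80Pv i) (m80Pv j) -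
          weilMarkovConstant (4023 / 5000 : ℝ) * ∫ x, (m80Pv i x * conj (m80Pv j x)).re) -
        (lam : ℝ) * ∫ x, (m80Pv i x * conj (m80Pv j x)).re)
    rt (fun i ↦ ((sW i : ℚ) : ℝ)) hsR (fun α ↦ by simpa only [hRm] using hN α)
  -- the weight in the bridge's form
  have hwform : ∀ y, w y = Ew.piecewise (fun _ ↦ 1 / (17 / 25 - (κ₂ : ℝ) - (lam : ℝ))) (fun _ ↦ 1 / (17 / 25 - (lam : ℝ))) y := by
    intro y
    by_cases hy' : y ∈ Ew
    · rw [hwdef, Set.piecewise_eq_of_mem _ _ _ hy', Set.piecewise_eq_of_mem _ _ _ hy', hwER]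
    · rw [hwdef, Set.piecewise_eq_of_notMem _ _ _ hy', Set.piecewise_eq_of_notMem _ _ _ hy', hwIR]
  have hPSD' : ∀ α : Fin 6 → ℝ, 0 ≤ ∑ i, ∑ j, α i * α j *
      ((weilPoleForm₂ (m80Pv i) (m80Pv j) + weilDirichletEnergy₂ (4023 / 5000 : ℝ) (m80Pv i) (m80Pv j) -
          weilMarkovConstant (4023 / 5000 : ℝ) * ∫ x, (m80Pv i x * conj (m80Pv j x)).re) -
        (lam : ℝ) * (∫ x, (m80Pv i x * conj (m80Pv j x)).re) -
        ∫ y, Ew.piecewise (fun _ ↦ 1 / (17 / 25 - (κ₂ : ℝ) - (lam : ℝ))) (fun _ ↦ 1 / (17 / 25 - (lam : ℝ))) y *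
          ((m80PF i - ∑ l, W i l • m80Pv l) y * conj ((m80PF j - ∑ l, W j l • m80Pv l) y)).re) := by
    intro α
    have h := hPSD α
    have e : ∀ i j, ∫ y, (rt i y * conj (rt j y)).re =
        ∫ y, Ew.piecewise (fun _ ↦ 1 / (17 / 25 - (κ₂ : ℝ) - (lam : ℝ))) (fun _ ↦ 1 / (17 / 25 - (lam : ℝ))) y *
          ((m80PF i - ∑ l, W i l • m80Pv l) y * conj ((m80PF j - ∑ l, W j l • m80Pv l) y)).re := by
      intro i j
      rw [hrt_cross]
      exact integral_congr_ae (Filter.Eventually.of_forall fun y ↦ by simp only [hr, hwform y])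
    simpa only [e] using h
  exact dt_weilEvenGroundEnergy_ge_of_deflCert_w hc hc5 le_rfl weilCertDeflM80PR 272 m80P_Reven.1 m80P_Reven.2 hcert
    m80Pv m80PF (fun i x ↦ (m80P_mask i x).symm) (fun i y ↦ rfl) W hκ hlamR hy hPSD'

end Summit.RiemannHypothesis.RiemannHypothesis.Theorems.EvenWinsBeyondArch

end
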